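import Summits.QuantumFields.YangMills.Theorems.LuscherReductionDressedRitzOfExcitedPlateau
import HarnessLib

/-!
# Route `LuscherReduction`, item `DressedRitz` (stmt-QuantumFields-20205) — reduction chain, file 8: the DEGENERATE INSTANCE `k = 0` is FREE —
# `ExcitedPlateauAt 0`, `OperatorPlateauAt 0`, `OrthoPlateauAt 0`, hence `DressedRitzAt 0`, hold unconditionally

Support module of the `FemtoTransferGap` group (fleet service by seat ym-infvol-p2 g6; route `LuscherReduction`, femto rung R2b1; bears on the
crux child `DressedRitz` = stmt-QuantumFields-20205 of RED stmt-QuantumFields-19978).  NEW (not in the planner's workfiles): the level-`0`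
slice of item 20205 and of every cut of the chain is a THEOREM — the shape check of the cuts (compare `explicitNoIntruder_zero` of
`…RunningReductionExplicitNoIntruder.lean` for the fifth KTR stub).

WHY.  At `k = 0` the cuts ask for NO excited generator (`Fin 0` is empty) and for SOME physical unit top eigenvector `φ` of the zero-flux transfer
operator, `K_βφ = λ₀φ` — which the tree supplies at every fixed lattice (`PhysL2.exists_isPhys_eigenfamily` at level `0`, `λ₀ > 0` by
`levelValue_zero_su2Rep_pos`).  Down the chain (`…OfExcitedPlateau`), `DressedRitzAt 0` — item 20205 at level `0`: a single physical unit vector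
`φ₀` whose Ritz value captures the top of the spectrum to `e^{ηλ/L}`, with residual Gram bound — holds with `φ₀ = Ω`, the exact ground state
(residual `0`).  So the content of item 20205 starts at `k = 1` (the gap level), exactly like RED.

* `KTGen.excitedPlateauAt_zero : ExcitedPlateauAt 0`, `KTGen.dressedRitzAt_zero : DressedRitzAt 0`, `KTGen.ritzGeneratorsAt_zero`,
  `KTGen.diagonalPlateauAt_zero`; `OpPlat.orthoPlateauAt_zero : OrthoPlateauAt 0`, `OpPlat.operatorPlateauAt_zero : OperatorPlateauAt 0`.

HONEST FRAMING: fixed-lattice spectral bookkeeping on the femto rung R2b1 (degenerate instance only); says nothing about `k ≥ 1`, where the XL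
renormalisation-group content of item 20205 lives; no bearing on infinite volume, the continuum limit or the Clay mass gap.
References: Reed–Simon IV, Thm. XIII.1 [cite: ReedSimonIV1978, Thm. XIII.1]; M. Lüscher, NPB 219 (1983) 233 [cite: Luscher1983, §3].
-/

set_option autoImplicit false

noncomputable section

open MeasureTheory Filter Topology Real
open Literature.MathematicalPhysics.QuantumFieldTheory
open Literature.MathematicalPhysics.QuantumLattice
open Literature.Analysis.OperatorTheory.YMMatrixModel
open scoped BigOperators

namespace Summit.QuantumFields.YangMills.Theorems.FemtoTransferGap

open Summit.QuantumFields.YangMills.Theorems.FemtoTransferGap.KTRCalibration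
open Summit.QuantumFields.YangMills.Theorems.FemtoTransferGap.PhysL2

/-- In the femto window there is a physical unit top eigenvector of `K_β` (the `k = 0` eigenfamily of `exists_isPhys_eigenfamily`).
[cite: ReedSimonIV1978, Thm. XIII.1] -/
theorem KTGen.exists_unit_top_eigenvector {L : ℕ} [NeZero L] {β : ℝ} (hβ : 0 ≤ β) :
    ∃ φ : GaugeConfig 3 L SU2 → ℝ, IsPhys φ ∧ l2 φ φ = 1 ∧ transferApply β φ = levelValue su2Rep L β 0 • φ := by
  obtain ⟨φ, hφ, hon, heig⟩ := exists_isPhys_eigenfamily hβ 0 (levelValue_zero_su2Rep_pos L β)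
  refine ⟨φ 0, hφ 0, ?_, ?_⟩
  · rw [hon 0 0, if_pos rfl]
  · rw [heig 0, Fin.val_zero]

/-- ★ **`ExcitedPlateauAt 0` holds unconditionally**: no excited generator is asked for, and the vacuum witness of (x3) exists at every fixed
lattice.  Constants `C = 0`, `lam0 = 1`, `L0 = 0`. [cite: ReedSimonIV1978, Thm. XIII.1] -/
theorem KTGen.excitedPlateauAt_zero : KTGen.ExcitedPlateauAt 0 := by
  refine ⟨0, 1, one_pos, fun lam _ _ => ⟨0, fun L _ _ β hW => ?_⟩⟩
  have hβ : (0 : ℝ) ≤ β := zero_le_one.trans hW.1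
  obtain ⟨φ, hφ, hφ1, hKφ⟩ := KTGen.exists_unit_top_eigenvector (L := L) hβ
  exact ⟨fun i => i.elim0, fun i => i.elim0, fun i => i.elim0, fun i => i.elim0, fun i => i.elim0,
    ⟨φ, hφ, hφ1, hKφ, fun i => i.elim0⟩, fun i => i.elim0, fun i => i.elim0, fun i => i.elim0, fun i => i.elim0⟩

/-- ★ **`DressedRitzAt 0` — item 20205 at level `0` — holds unconditionally** (down the chain from `excitedPlateauAt_zero`; concretely `φ₀ = Ω`,
the exact ground state, residual `0`). [cite: ReedSimonIV1978, Thm. XIII.1] -/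
theorem KTGen.dressedRitzAt_zero : KTGen.DressedRitzAt 0 :=
  KTGen.dressedRitzAt_of_excitedPlateauAt KTGen.excitedPlateauAt_zero

/-- `RitzGeneratorsAt 0` holds unconditionally. [cite: ReedSimonIV1978, Thm. XIII.1] -/
theorem KTGen.ritzGeneratorsAt_zero : KTGen.RitzGeneratorsAt 0 :=
  KTGen.ritzGeneratorsAt_of_excitedPlateauAt KTGen.excitedPlateauAt_zero

/-- `DiagonalPlateauAt 0` holds unconditionally. [cite: ReedSimonIV1978, Thm. XIII.1] -/
theorem KTGen.diagonalPlateauAt_zero : KTGen.DiagonalPlateauAt 0 :=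
  KTGen.diagonalPlateauAt_of_excitedPlateauAt KTGen.excitedPlateauAt_zero

/-- ★ **`OrthoPlateauAt 0` holds unconditionally** (`PlateauClauses 0 …` is a conjunction of statements over the empty type `Fin 0`).
[cite: ReedSimonIV1978, Thm. XIII.1] -/
theorem OpPlat.orthoPlateauAt_zero : OpPlat.OrthoPlateauAt 0 := by
  refine ⟨0, 1, le_rfl, one_pos, fun lam _ _ => ⟨0, fun L _ _ β hW => ?_⟩⟩
  have hβ : (0 : ℝ) ≤ β := zero_le_one.trans hW.1
  obtain ⟨φ, hφ, hφ1, hKφ⟩ := KTGen.exists_unit_top_eigenvector (L := L) hβ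
  exact ⟨φ, hφ, hφ1, hKφ, fun i => i.elim0, fun i => i.elim0, fun i => i.elim0,
    ⟨fun i => i.elim0, fun i => i.elim0, fun i => i.elim0, fun i => i.elim0, fun i => i.elim0, fun i => i.elim0, fun i => i.elim0⟩⟩

/-- ★ **`OperatorPlateauAt 0` holds unconditionally** (no insertion is asked for). [cite: ReedSimonIV1978, Thm. XIII.1] -/
theorem OpPlat.operatorPlateauAt_zero : OpPlat.OperatorPlateauAt 0 := by
  refine ⟨0, 1, le_rfl, one_pos, fun lam _ _ => ⟨0, fun L _ _ β hW => ?_⟩⟩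
  have hβ : (0 : ℝ) ≤ β := zero_le_one.trans hW.1
  obtain ⟨φ, hφ, hφ1, hKφ⟩ := KTGen.exists_unit_top_eigenvector (L := L) hβ
  exact ⟨φ, hφ, hφ1, hKφ, fun i => i.elim0, fun i => i.elim0,
    ⟨fun i => i.elim0, fun i => i.elim0, fun i => i.elim0, fun i => i.elim0, fun i => i.elim0, fun i => i.elim0, fun i => i.elim0⟩⟩

end Summit.QuantumFields.YangMills.Theorems.FemtoTransferGap

end
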